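import Mathlib.RepresentationTheory.Intertwining
import Mathlib.RepresentationTheory.Irreducible
import Mathlib.LinearAlgebra.Dimension.FreeAndStrongRankCondition
import Mathlib.Algebra.DirectSum.Module
import Literature.NumberTheory.Automorphic.RestrictedTensorProductIrreducibleProofs
import HarnessLib

/-!
# FLOOR-0 P3 «U3-mult», line `F0_U3CohMultOne` — the SCHUR LINE LEMMA (letter-independent, generic): multiplicity at most one out
# of an irreducible representation with SCALAR COMMUTANT, and the lift of equivariant sub-module-valued maps to intertwiners

Cell hodgecm-mathlib, FLOOR 0; crux item H413 = stmt-HodgeConjecture-24833; line `Cruxes/H413/Lines/F0_U3CohMultOne.lean` v1.1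
(cf02d7697f46cc99, F0P3-plan (g0)); seat F0P3-p03 (JOIN-BRIEF §3 p03: «report-first the Schur lemma over `Representation.IntertwiningMap`
first — it is letter-independent»).  GENERIC representation theory; theorems only (no definition, no named fact, no `sorry`); nothing of
[Liu2021] ∕ [Rogawski1990] is asserted; HC_CM is proved only modulo the printed citations until rung 0 closes.  Companion of ★
`AdmissibleDirectSumMultiplicityOne.lean` (same shapes, where Schur's lemma is applied on ADMISSIBLE SUMMANDS of the target); here the
one analytic input — «every `G`-endomorphism of `ρ` is a scalar», `End_G(ρ) = k · id` — is a HYPOTHESIS ON THE SOURCE `ρ` (for instance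
an irreducible admissible representation of a group with a compact open subgroup over an algebraically closed field, ★
`Representation.IsAdmissible.exists_eq_smul_id`, [Bump1997, Prop. 4.2.4]; or any irreducible of countable dimension over `ℂ`), and
NOTHING but irreducibility-or-zero and pairwise non-isomorphy is asked of the target's summands.  This is the form consumed by the
registered stubs S3 ∕ S4 of the line («the equivariant holomorphic-cotangent-valued maps out of `ω_V(t)` lie on ONE LINE»), where the
source `ω_V(t)` is irreducible admissible at the pin ([Liu2021, Def. 4.11] = ★ `Theorems.H411_proof`; sibling
`Theorems/F0P3SchurLineAtPin.lean` discharges the scalar commutant there) while the target is a space of automorphic forms decomposed à la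
Matsushima ([BorelWallach2000, VII 3.2]) whose summands' admissibility is a separate debt of the junction.

## Content (namespace `Summit.HodgeConjecture.HodgeConjecture.Cruxes.H413.F0P3SchurLine`; `k` a field, `G` a group)
* `exists_line_of_rank_intertwiningMap_le_one` — THE LIFT: for representations `ρ`, `R`, `τ` on `W`, `X`, `Y`, a submodule `A ≤ X`
  and an INJECTIVE equivariant `j : Y → X`: if every equivariant `A`-valued linear `ψ : W → X` takes values in `range j` and
  `rank_k Hom_G(ρ, τ) ≤ 1`, then `∃ ψ₀, ∀ ψ` (equivariant, `A`-valued) `∃ r, ψ = r • ψ₀`.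
* `eq_zero_or_bijective_of_irreducibleOrZero` — an intertwiner from an irreducible into an irreducible-or-zero representation is
  zero or bijective.
* `exists_eq_smul_of_ne_zero_of_scalar_comm`, `rank_intertwiningMap_le_one_of_scalar_comm` — SCHUR, Hom-space form: `ρ` irreducible
  with scalar commutant, `τ` irreducible or zero ⟹ every intertwiner `ρ → τ` is a multiple of any non-zero one; `rank_k Hom_G(ρ, τ) ≤ 1`.
* `rank_intertwiningMap_le_one_of_subsingleton` — the degenerate source `W = 0`.
* `exists_component`, `index_eq_of_ne_zero`, `apply_eq_symm_lof` — direct-sum plumbing (public versions of the private lemmas of ★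
  `AdmissibleDirectSumMultiplicityOne`).
* `exists_eq_smul_of_ne_zero_of_scalar_comm_of_directSum`, `rank_intertwiningMap_le_one_of_scalar_comm_of_directSum` — the same into a
  target `G`-isomorphic to `⨁ i, σ i` with the `σ i` irreducible-or-zero and PAIRWISE NON-ISOMORPHIC.

## References
* [Bump1997] D. Bump, *Automorphic Forms and Representations*, CUP 1997 — Prop. 4.2.4 (Schur's lemma for irreducible admissible
  representations) and §4.2.
* [BernsteinZelevinsky1976] I. N. Bernstein, A. V. Zelevinsky, Russian Math. Surveys 31:3 (1976) — 2.11.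
* [BorelWallach2000] A. Borel, N. Wallach, *Continuous cohomology, discrete subgroups, and representations of reductive groups*, 2nd ed.
  (2000) — VII 3.2 (Matsushima's formula: the shape of the direct-sum target).
* [Liu2021] Y. Liu, Camb. J. Math. 9 (2021) — Def. 4.11; proof of Prop. 4.13, l. 2145 (the consumer's multiplicity-one sentence).
-/

set_option autoImplicit false

-- the mandated namespace has the single-problem summit's repeated segment (`HodgeConjecture.HodgeConjecture`)
set_option linter.dupNamespace false

noncomputable section

namespace Summit.HodgeConjecture.HodgeConjecture.Cruxes.H413.F0P3SchurLine

open scoped DirectSum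

/-! ## The lift to intertwiners; Schur's lemma in Hom-space form, scalar commutant on the source -/

section Generic

universe uk uG uW uX uY uH uι uS

variable {k : Type uk} [Field k] {G : Type uG} [Group G]
variable {W : Type uW} [AddCommGroup W] [Module k W] {X : Type uX} [AddCommGroup X] [Module k X]
variable {Y : Type uY} [AddCommGroup Y] [Module k Y]

/-- **THE LIFT.**  Let `ρ`, `R`, `τ` be representations of `G` on `W`, `X`, `Y`, `A ≤ X`, and `j : Y → X` an INJECTIVE linear map
intertwining `τ` with `R`.  If every `G`-equivariant `A`-valued linear map `ψ : W → X` takes values in `range j`, and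
`rank_k Hom_G(ρ, τ) ≤ 1`, then those `ψ` lie on one line: `∃ ψ₀, ∀ ψ, ψ = r • ψ₀`.  (Each `ψ` lifts uniquely along `j` to an
intertwiner `ρ → τ`; the lift is injective and linear.) [folklore] -/
theorem exists_line_of_rank_intertwiningMap_le_one (ρ : Representation k G W) (R : Representation k G X)
    (A : Submodule k X) (τ : Representation k G Y) (j : Y →ₗ[k] X) (hj : Function.Injective j)
    (hjeqv : ∀ (g : G) (y : Y), j (τ g y) = R g (j y))
    (hA : ∀ ψ : W →ₗ[k] X, (∀ (g : G) (w : W), ψ (ρ g w) = R g (ψ w)) → (∀ w, ψ w ∈ A) →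
      ∀ w, ψ w ∈ LinearMap.range j)
    (hrank : Module.rank k (ρ.IntertwiningMap τ) ≤ 1) :
    ∃ ψ₀ : W →ₗ[k] X, ∀ ψ : W →ₗ[k] X,
      (∀ (g : G) (w : W), ψ (ρ g w) = R g (ψ w)) → (∀ w, ψ w ∈ A) → ∃ r : k, ψ = r • ψ₀ := by
  obtain ⟨φ₀, hφ₀⟩ := rank_le_one_iff.mp hrank
  refine ⟨j ∘ₗ φ₀.toLinearMap, fun ψ hψ hmem => ?_⟩
  -- lift `ψ` along the injection `j`
  let e : Y ≃ₗ[k] ↥(LinearMap.range j) := LinearEquiv.ofInjective j hj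
  let ψ' : W →ₗ[k] Y :=
    (e.symm : ↥(LinearMap.range j) →ₗ[k] Y) ∘ₗ LinearMap.codRestrict (LinearMap.range j) ψ (hA ψ hψ hmem)
  have hjψ' : ∀ w, j (ψ' w) = ψ w := by
    intro w
    have h2 := congrArg Subtype.val (e.apply_symm_apply (LinearMap.codRestrict (LinearMap.range j) ψ (hA ψ hψ hmem) w))
    rw [LinearEquiv.ofInjective_apply] at h2
    exact h2
  have hψ'eqv : ∀ (g : G) (w : W), ψ' (ρ g w) = τ g (ψ' w) := by
    intro g w
    apply hj
    rw [hjψ', hjeqv, hjψ', hψ]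
  obtain ⟨r, hr⟩ := hφ₀ (ψ'.intertwiningMap_of_isIntertwiningMap ρ τ hψ'eqv)
  refine ⟨r, LinearMap.ext fun w => ?_⟩
  have hrw : r • φ₀ w = ψ' w := by
    have := congrArg (fun φ : ρ.IntertwiningMap τ => φ w) hr
    simpa only [Representation.IntertwiningMap.smul_apply, LinearMap.toIntertwiningMap] using this
  rw [← hjψ' w, ← hrw, map_smul]
  rfl

/-- An intertwiner out of an irreducible `ρ` into an irreducible-or-zero `τ` is zero or bijective (kernels and images of
intertwiners are subrepresentations). [folklore] -/
theorem eq_zero_or_bijective_of_irreducibleOrZero {ρ : Representation k G W} [ρ.IsIrreducible] {τ : Representation k G Y}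
    (hirr : Nontrivial Y → τ.IsIrreducible) (f : ρ.IntertwiningMap τ) : f = 0 ∨ Function.Bijective f := by
  by_cases hY : Nontrivial Y
  · haveI := hirr hY
    exact (Representation.IsIrreducible.bijective_or_eq_zero f).symm
  · left
    haveI : Subsingleton Y := not_nontrivial_iff_subsingleton.mp hY
    exact Representation.IntertwiningMap.ext (LinearMap.ext fun v => Subsingleton.elim _ _)

/-- **SCHUR, Hom-space form, scalar commutant on the source.**  Let `ρ` be irreducible with `End_G(ρ) = k · id` (every linear
`T : W → W` commuting with `ρ(G)` is a scalar) and `τ` irreducible or zero.  If `g : ρ → τ` is a non-zero intertwiner, every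
intertwiner `f : ρ → τ` is `c • g`: `g` is an isomorphism and `g⁻¹ ∘ f ∈ End_G(ρ)` is a scalar `c`.
[cite: Bump1997, Proposition 4.2.4] -/
theorem exists_eq_smul_of_ne_zero_of_scalar_comm {ρ : Representation k G W} [ρ.IsIrreducible]
    (hs : ∀ T : W →ₗ[k] W, (∀ g : G, T ∘ₗ ρ g = ρ g ∘ₗ T) → ∃ c : k, T = c • LinearMap.id)
    {τ : Representation k G Y} (hirr : Nontrivial Y → τ.IsIrreducible)
    {g : ρ.IntertwiningMap τ} (hg : g ≠ 0) (f : ρ.IntertwiningMap τ) : ∃ c : k, f = c • g := by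
  have hbij := (eq_zero_or_bijective_of_irreducibleOrZero hirr g).resolve_left hg
  let e : ρ.Equiv τ := g.ofBijective hbij
  obtain ⟨c, hc⟩ := hs (e.toLinearEquiv.symm.toLinearMap ∘ₗ f.toLinearMap) fun x => by
    apply LinearMap.ext
    intro w
    simp only [LinearMap.coe_comp, Function.comp_apply, LinearEquiv.coe_coe, Representation.IntertwiningMap.coe_toLinearMap,
      Representation.Equiv.coe_symm]
    rw [f.isIntertwining ρ τ x w, ← Representation.Equiv.coe_toIntertwiningMap, (e.symm.toIntertwiningMap).isIntertwining τ ρ x]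
  refine ⟨c, Representation.IntertwiningMap.ext (LinearMap.ext fun w => ?_)⟩
  have hw := congr($hc w)
  simp only [LinearMap.coe_comp, Function.comp_apply, LinearEquiv.coe_coe, Representation.IntertwiningMap.coe_toLinearMap,
    LinearMap.smul_apply, LinearMap.id_apply] at hw
  -- `e.symm (f w) = c • w`; apply `e`
  have hw' : f w = e.toLinearEquiv (c • w) := by
    rw [← hw, LinearEquiv.apply_symm_apply]
  show f w = c • g w
  rw [hw', map_smul]
  rfl

/-- **`rank_k Hom_G(ρ, τ) ≤ 1`** for `ρ` irreducible with scalar commutant and `τ` irreducible or zero.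
[cite: Bump1997, Proposition 4.2.4] -/
theorem rank_intertwiningMap_le_one_of_scalar_comm {ρ : Representation k G W} [ρ.IsIrreducible]
    (hs : ∀ T : W →ₗ[k] W, (∀ g : G, T ∘ₗ ρ g = ρ g ∘ₗ T) → ∃ c : k, T = c • LinearMap.id)
    {τ : Representation k G Y} (hirr : Nontrivial Y → τ.IsIrreducible) :
    Module.rank k (ρ.IntertwiningMap τ) ≤ 1 := by
  rw [rank_le_one_iff]
  by_cases h0 : ∀ g : ρ.IntertwiningMap τ, g = 0
  · exact ⟨0, fun f => ⟨0, by rw [h0 f, smul_zero]⟩⟩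
  · push Not at h0
    obtain ⟨g, hg⟩ := h0
    refine ⟨g, fun f => ?_⟩
    obtain ⟨c, hc⟩ := exists_eq_smul_of_ne_zero_of_scalar_comm hs hirr hg f
    exact ⟨c, hc.symm⟩

/-- **Degenerate source.**  If `W = 0` then `Hom_G(ρ, τ) = 0` has rank `≤ 1`. [folklore] -/
theorem rank_intertwiningMap_le_one_of_subsingleton (ρ : Representation k G W) (τ : Representation k G Y) [Subsingleton W] :
    Module.rank k (ρ.IntertwiningMap τ) ≤ 1 := by
  rw [rank_le_one_iff]
  refine ⟨0, fun f => ⟨0, ?_⟩⟩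
  rw [smul_zero]
  exact (Representation.IntertwiningMap.ext (LinearMap.ext fun w => by
    rw [Subsingleton.elim w 0, map_zero, map_zero])).symm

/-! ### Direct-sum targets (Matsushima shape): pairwise non-isomorphic irreducible-or-zero summands -/

variable {H : Type uH} [AddCommGroup H] [Module k H]
variable {ι : Type uι} {S : ι → Type uS} [∀ i, AddCommGroup (S i)] [∀ i, Module k (S i)] {σ : ∀ i, Representation k G (S i)}

/-- The `i`-th component `π_i ∘ Φ ∘ f : ρ → σ i` of an intertwiner `f : ρ → τ`, read through an equivariant decomposition
`Φ : H ≃ ⨁ i, S i`, is an intertwiner. [folklore] -/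
theorem exists_component {ρ : Representation k G W} {τ : Representation k G H} (Φ : H ≃ₗ[k] ⨁ i, S i)
    (hΦ : ∀ (g : G) (x : H) (i : ι), Φ (τ g x) i = σ i g (Φ x i)) (f : ρ.IntertwiningMap τ) (i : ι) :
    ∃ c : ρ.IntertwiningMap (σ i), ∀ v, c v = Φ (f v) i :=
  ⟨LinearMap.intertwiningMap_of_isIntertwiningMap ρ (σ i)
      (DirectSum.component k ι S i ∘ₗ Φ.toLinearMap ∘ₗ f.toLinearMap) fun g v => by
        show DirectSum.component k ι S i (Φ (f (ρ g v))) = σ i g (DirectSum.component k ι S i (Φ (f v)))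
        rw [← DirectSum.apply_eq_component, ← DirectSum.apply_eq_component, f.isIntertwining, hΦ],
    fun _ => rfl⟩

/-- Two non-zero intertwiners out of an irreducible `ρ` into summands `σ i`, `σ j` that are irreducible or zero and pairwise
non-isomorphic force `i = j`. [folklore] -/
theorem index_eq_of_ne_zero {ρ : Representation k G W} [ρ.IsIrreducible] (hirr : ∀ i, Nontrivial (S i) → (σ i).IsIrreducible)
    (hsep : ∀ i j, Nontrivial (S i) → Nonempty ((σ i).Equiv (σ j)) → i = j) {i j : ι}
    {c : ρ.IntertwiningMap (σ i)} {c' : ρ.IntertwiningMap (σ j)} (hi : c ≠ 0) (hj : c' ≠ 0) : i = j := by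
  haveI : Nontrivial W := Representation.IsIrreducible.nontrivial ρ
  have hbi := (eq_zero_or_bijective_of_irreducibleOrZero (hirr i) c).resolve_left hi
  have hbj := (eq_zero_or_bijective_of_irreducibleOrZero (hirr j) c').resolve_left hj
  exact hsep i j hbi.1.nontrivial ⟨(c.ofBijective hbi).symm.trans (c'.ofBijective hbj)⟩

/-- If every component of `Φ (f v)` off the index `i₀` vanishes then `f v = Φ⁻¹ (ι_{i₀} (Φ (f v) i₀))`. [folklore] -/
theorem apply_eq_symm_lof [DecidableEq ι] {ρ : Representation k G W} {τ : Representation k G H} (Φ : H ≃ₗ[k] ⨁ i, S i)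
    {f : ρ.IntertwiningMap τ} {i₀ : ι} {v : W} (h : ∀ j, j ≠ i₀ → Φ (f v) j = 0) :
    f v = Φ.symm (DirectSum.lof k ι S i₀ (Φ (f v) i₀)) := by
  rw [LinearEquiv.eq_symm_apply]
  refine DirectSum.ext_component k fun j => ?_
  rw [← DirectSum.apply_eq_component, ← DirectSum.apply_eq_component, DirectSum.lof_eq_of]
  by_cases hj : j = i₀
  · subst hj
    rw [DirectSum.of_eq_same]
  · rw [DirectSum.of_eq_of_ne _ _ _ hj, h j hj]

/-- **SCHUR into a direct sum, scalar commutant on the source.**  Let `τ ≅ ⨁ i, σ i` `G`-equivariantly with the `σ i` irreducible or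
zero and pairwise non-isomorphic, and `ρ` irreducible with `End_G(ρ) = k · id`.  If `g : ρ → τ` is a non-zero intertwiner then every
intertwiner `f : ρ → τ` is `c • g` (both factor through the one summand `σ i₀` isomorphic to `ρ`; `(π_{i₀} g)⁻¹ ∘ π_{i₀} f ∈ End_G(ρ)`).
No admissibility is asked of the summands. [cite: Bump1997, Proposition 4.2.4] -/
theorem exists_eq_smul_of_ne_zero_of_scalar_comm_of_directSum {ρ : Representation k G W} [ρ.IsIrreducible]
    (hs : ∀ T : W →ₗ[k] W, (∀ g : G, T ∘ₗ ρ g = ρ g ∘ₗ T) → ∃ c : k, T = c • LinearMap.id)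
    {τ : Representation k G H} (Φ : H ≃ₗ[k] ⨁ i, S i) (hΦ : ∀ (g : G) (x : H) (i : ι), Φ (τ g x) i = σ i g (Φ x i))
    (hirr : ∀ i, Nontrivial (S i) → (σ i).IsIrreducible) (hsep : ∀ i j, Nontrivial (S i) → Nonempty ((σ i).Equiv (σ j)) → i = j)
    {g : ρ.IntertwiningMap τ} (hg : g ≠ 0) (f : ρ.IntertwiningMap τ) : ∃ c : k, f = c • g := by
  classical
  haveI : Nontrivial W := Representation.IsIrreducible.nontrivial ρ
  -- the components `cp f i : ρ → σ i`, `cp f i v = Φ (f v) i`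
  choose cp hcp using exists_component (ρ := ρ) Φ hΦ
  -- `g ≠ 0` has a non-zero component `i₀`
  obtain ⟨i₀, hi₀⟩ : ∃ i₀, cp g i₀ ≠ 0 := by
    by_contra hall
    push Not at hall
    apply hg
    refine Representation.IntertwiningMap.ext (LinearMap.ext fun v => ?_)
    change g v = 0
    apply Φ.injective
    rw [map_zero]
    refine DirectSum.ext_component k fun j => ?_
    rw [← DirectSum.apply_eq_component, ← DirectSum.apply_eq_component, ← hcp g j v, hall j]
    rfl
  -- every intertwiner has all its components off `i₀` equal to zero
  have hoff : ∀ (f : ρ.IntertwiningMap τ) (v : W) (j : ι), j ≠ i₀ → Φ (f v) j = 0 := by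
    intro f v j hj
    by_cases hne : cp f j = 0
    · rw [← hcp f j v, hne]
      rfl
    · exact absurd (index_eq_of_ne_zero hirr hsep hne hi₀) hj
  -- Schur on `ρ` for the two components at `i₀`
  obtain ⟨c, hc⟩ := exists_eq_smul_of_ne_zero_of_scalar_comm hs (hirr i₀) hi₀ (cp f i₀)
  have hcomp : ∀ v, cp f i₀ v = c • cp g i₀ v := fun v => by rw [hc]; rfl
  refine ⟨c, Representation.IntertwiningMap.ext (LinearMap.ext fun v => ?_)⟩
  show f v = c • g v
  rw [apply_eq_symm_lof Φ (hoff f v), apply_eq_symm_lof Φ (hoff g v), ← hcp, ← hcp, hcomp, map_smul, map_smul]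

/-- **`rank_k Hom_G(ρ, τ) ≤ 1` into a direct sum of pairwise non-isomorphic irreducible-or-zero summands**, for `ρ` irreducible with
scalar commutant (the Matsushima shape of the multiplicity-one sentence of [Liu2021, Prop. 4.13, proof l. 2145]; compare ★
`AdmissibleDirectSum.rank_intertwiningMap_le_one_of_equivariant_directSum`, admissibility on the summands instead).
[cite: Bump1997, Proposition 4.2.4] [cite: Liu2021, proof of Prop. 4.13, l. 2145] -/
theorem rank_intertwiningMap_le_one_of_scalar_comm_of_directSum {ρ : Representation k G W} [ρ.IsIrreducible]
    (hs : ∀ T : W →ₗ[k] W, (∀ g : G, T ∘ₗ ρ g = ρ g ∘ₗ T) → ∃ c : k, T = c • LinearMap.id)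
    {τ : Representation k G H} (Φ : H ≃ₗ[k] ⨁ i, S i) (hΦ : ∀ (g : G) (x : H) (i : ι), Φ (τ g x) i = σ i g (Φ x i))
    (hirr : ∀ i, Nontrivial (S i) → (σ i).IsIrreducible) (hsep : ∀ i j, Nontrivial (S i) → Nonempty ((σ i).Equiv (σ j)) → i = j) :
    Module.rank k (ρ.IntertwiningMap τ) ≤ 1 := by
  rw [rank_le_one_iff]
  by_cases h0 : ∀ g : ρ.IntertwiningMap τ, g = 0
  · exact ⟨0, fun f => ⟨0, by rw [h0 f, smul_zero]⟩⟩
  · push Not at h0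
    obtain ⟨g, hg⟩ := h0
    refine ⟨g, fun f => ?_⟩
    obtain ⟨c, hc⟩ := exists_eq_smul_of_ne_zero_of_scalar_comm_of_directSum hs Φ hΦ hirr hsep hg f
    exact ⟨c, hc.symm⟩

end Generic

end Summit.HodgeConjecture.HodgeConjecture.Cruxes.H413.F0P3SchurLine

end
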